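import Summits.QuantumFields.YangMills.Theorems.AllWindowsColdBoxBoxHighLineK3PrimeRowE1WilsonGauss
import Summits.QuantumFields.YangMills.Theorems.AllWindowsColdBoxBoxHighLineCum3TriangleMuSet
import Summits.QuantumFields.YangMills.Theorems.AllWindowsColdBoxBoxHighLineConnectedFourPointCubicMuSet
import Summits.QuantumFields.YangMills.Theorems.AllWindowsColdBoxBoxHighLineTiltUEvenL2Prelims
import Summits.QuantumFields.YangMills.Theorems.AllWindowsColdBoxBoxHighLineQuarticL2

/-!
# K3′ exact row E1 (Wilson quartic vertex) ON THE CUT SMALL-FIELD SET `μ_{D′}`: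
# `|κ₃,₀^{μ_{D′}}(L_x, L_y; β·Σ_z Q⁴_z)| ≤ β⁻³·C·B·(1+log H)⁵·(1 + √τ·H⁴)` (ASSEMBLY-U5 §8, E1 chain (β); hK3 ROW-SUM hypothesis `hE1r`, Wilson half)

Width seat `ym-line-sfw-p2-w3` (g42), cell ym-idea-1 (planner ym-idea-2 g18 RULING 2026-08-30T01:12:48Z; fcl-p3 g27's hK3 ROW-SUM letters 01:48:20Z: «each of you just lands
`|κ₃ μD (your vertex) 0 (linCurvSq H (x,μ₁,ν₁)) (linCurvSq H (y,μ₂,ν₂))| ≤ β⁻¹^3·C′·L⁵·(1+√τ·H⁴)`»).  This file moves this seat's E₀-exact core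
✓`EdgeChartGaussian.abs_gaussCum3_centredLinCurvSq_quarticPairVertex_le` onto the restricted Gaussian `μ_{D′}` (`D′ ⊆ smallField H s` measurable, co-mass
`E₀[1 − 1_{D′}] ≤ τ ≤ 1/2`), in the pattern of fcl-p3 g27's ✓`GaussRestrict.abs_tiltCum3_muSet_linCurvSq_linCurvSq_quadVal_le` (K3′(a)):

* `WilsonTaylor.abs_quarticPairSum_le` — pointwise `|Σ_{ijkl} Q_{ijkl}(v_i·v_j)(v_k·v_l)| ≤ 16B·(Σ_i‖v_i‖²)²`;
* `EdgeChartGaussian.polyCert_quarticPairVertex`, `gaussAvg_quarticPairVertex_sq_le` — `W := β·Σ_{z touching} Σ_{ijkl} Q…(plaqVar_z)` is a certified polynomial of degree 4 and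
  `E₀[W²] ≤ C_W·B²·H⁸/β²` (crude: Cauchy–Schwarz over the plaquettes + ✓`PlaqObsL2.gaussAvg_edgeSq_pow_four_le`, as in ✓`QuarticL2Proof`; it only feeds the √τ transfer term);
* ★★ `GaussRestrict.abs_tiltCum3_muSet_linCurvSq_linCurvSq_quarticPairVertex_le` — `∃ C ≥ 0, ∀ H ≥ 1, β > 0, B, Q with |Q_{ijkl}| ≤ B, x y μ₁ ν₁ μ₂ ν₂, 0 ≤ s,
  D ⊆ smallField H s measurable, E₀[1 − 1_D] ≤ τ ≤ 1/2:`
  `|Tilt.tiltCum3 μ_D W 0 (linCurvSq H (x,μ₁,ν₁)) (linCurvSq H (y,μ₂,ν₂))| ≤ β⁻¹^3·(C·B·(1+log H)⁵·(1 + √τ·H⁴))`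
  (E₀-side `C·B·L⁵/β³` uniform; transfer `3728·√τ·u²v`, `u² = C_V L²/β²` ✓`gaussAvg_centred_linCurvSq_sq_le`, `v² = C_W B²H⁸/β²`, Bonami–Nelson degrees (2,2,4)).
INSTANCE OF RECORD: `Q` := the quartic tensor of ✓`WilsonTaylor.exists_quarticTensor_quarticWilson` (`B = 1/2`), i.e. `W = −(−quarticWilson) + O(βH⁴s⁶)`; the sign and the sextic
remainder row (K7) are the ROW-SUM's (✓`tiltCum3_zero_const_mul_third`, w4 g30's sup×L² rows).  RELATIVE (`×β²H⁸`): `H⁸L⁵/β` [8θ−1 < 0] and `√τ·H¹²L⁵/β` [q ≥ 1: 12θ − 3/2 < 0] —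
strict for every `θ < 1/10` at `κ₃ = 1/8 − θ/4` (the row does not see `κ₃`).

Tree only; no definitions; standard axioms.  HONEST LABEL: helper-grade glue for the RECORDED lift L2 of the NEXT rung U5 (⟨stmt-QuantumFields-24336⟩, UNSTAFFED; hK3 is CONDITIONAL
bookkeeping until every row lands); ⟨24004⟩ ⟨24336⟩ and this seat's crux ⟨stmt-QuantumFields-22884⟩ remain OPEN; route AllWindowsColdBox is DRAFT; no crux, rung or summit is
proved; **the Yang–Mills mass gap is NOT proved by this file; no summit is proved by a line.**
-/

set_option autoImplicit false

noncomputable section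

open MeasureTheory Matrix Finset
open Literature.Probability.LatticeModels (Site)
open Literature.MathematicalPhysics.QuantumLattice (ZdPlaquette plaquettesTouching)
open Literature.MathematicalPhysics.QuantumFieldTheory (Plaq)
open Literature.MathematicalPhysics.QuantumFieldTheory.AxialGauge (boxEdges)

namespace Summit.QuantumFields.YangMills.Theorems.AllWindowsColdBoxBoxHighLine

/-! ## §1 Pointwise size of a quartic pair form -/

namespace WilsonTaylor

/-- `Σ_{ijkl} n_in_jn_kn_l = (Σ n)⁴` on `Fin 4`. -/
theorem sum_four_prod_eq_pow (n : Fin 4 → ℝ) : ∑ i : Fin 4, ∑ j : Fin 4, ∑ k : Fin 4, ∑ l : Fin 4, n i * n j * n k * n l = (∑ i, n i) ^ 4 := by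
  simp only [Fin.sum_univ_four]
  ring

/-- ★ **Pointwise**: `|Σ_{ijkl} Q_{ijkl}(v_i·v_j)(v_k·v_l)| ≤ 16·B·(Σ_i ‖v_i‖²)²` for `|Q| ≤ B`. -/
theorem abs_quarticPairSum_le (Q : Fin 4 → Fin 4 → Fin 4 → Fin 4 → ℝ) {B : ℝ} (hQ : ∀ i j k l, |Q i j k l| ≤ B) (v : Fin 4 → E3) :
    |∑ i : Fin 4, ∑ j : Fin 4, ∑ k : Fin 4, ∑ l : Fin 4, Q i j k l *
        ((WithLp.ofLp (v i) ⬝ᵥ WithLp.ofLp (v j)) * (WithLp.ofLp (v k) ⬝ᵥ WithLp.ofLp (v l)))| ≤ 16 * B * (∑ i, ‖v i‖ ^ 2) ^ 2 := by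
  have hB : 0 ≤ B := (abs_nonneg _).trans (hQ 0 0 0 0)
  have hd : ∀ i j : Fin 4, |WithLp.ofLp (v i) ⬝ᵥ WithLp.ofLp (v j)| ≤ ‖v i‖ * ‖v j‖ := fun i j =>
    PlaqCost.abs_dotProduct_le_of _ _ (WilsonSandwich.sqrt_dot_self (v i)).le (WilsonSandwich.sqrt_dot_self (v j)).le (norm_nonneg _)
  have hterm : ∀ i j k l : Fin 4, |Q i j k l * ((WithLp.ofLp (v i) ⬝ᵥ WithLp.ofLp (v j)) * (WithLp.ofLp (v k) ⬝ᵥ WithLp.ofLp (v l)))| ≤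
      B * (‖v i‖ * ‖v j‖ * ‖v k‖ * ‖v l‖) := by
    intro i j k l
    rw [abs_mul, abs_mul]
    calc |Q i j k l| * (|WithLp.ofLp (v i) ⬝ᵥ WithLp.ofLp (v j)| * |WithLp.ofLp (v k) ⬝ᵥ WithLp.ofLp (v l)|)
        ≤ B * ((‖v i‖ * ‖v j‖) * (‖v k‖ * ‖v l‖)) :=
          mul_le_mul (hQ i j k l) (mul_le_mul (hd i j) (hd k l) (abs_nonneg _) (by positivity)) (by positivity) hB
      _ = _ := by ring
  have hcs : (∑ i, ‖v i‖) ^ 2 ≤ 4 * ∑ i, ‖v i‖ ^ 2 := by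
    have h := sq_sum_le_card_mul_sum_sq (s := (Finset.univ : Finset (Fin 4))) (f := fun i => ‖v i‖)
    simp only [Finset.card_univ, Fintype.card_fin] at h
    exact_mod_cast h
  have hs0 : 0 ≤ ∑ i, ‖v i‖ := Finset.sum_nonneg fun i _ => norm_nonneg _
  calc _ ≤ ∑ i : Fin 4, ∑ j : Fin 4, ∑ k : Fin 4, ∑ l : Fin 4, B * (‖v i‖ * ‖v j‖ * ‖v k‖ * ‖v l‖) := by
        refine (Finset.abs_sum_le_sum_abs _ _).trans (Finset.sum_le_sum fun i _ => ?_)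
        refine (Finset.abs_sum_le_sum_abs _ _).trans (Finset.sum_le_sum fun j _ => ?_)
        refine (Finset.abs_sum_le_sum_abs _ _).trans (Finset.sum_le_sum fun k _ => ?_)
        exact (Finset.abs_sum_le_sum_abs _ _).trans (Finset.sum_le_sum fun l _ => hterm i j k l)
    _ = B * (∑ i, ‖v i‖) ^ 4 := by
        rw [← sum_four_prod_eq_pow]
        simp only [Finset.mul_sum]
    _ = B * ((∑ i, ‖v i‖) ^ 2) ^ 2 := by ring
    _ ≤ B * (4 * ∑ i, ‖v i‖ ^ 2) ^ 2 := mul_le_mul_of_nonneg_left (pow_le_pow_left₀ (sq_nonneg _) hcs 2) hB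
    _ = 16 * B * (∑ i, ‖v i‖ ^ 2) ^ 2 := by ring

end WilsonTaylor

/-! ## §2 The polynomial quartic Wilson vertex: certificate and crude second moment -/

namespace EdgeChartGaussian

open LaplaceSandwich (flatten)

variable {H : ℕ}

/-- `W = β·Σ_{z touching} Σ_{ijkl} Q…(plaqVar_z)` is a certified polynomial of degree `≤ 4`. -/
theorem polyCert_quarticPairVertex (β : ℝ) (Q : Fin 4 → Fin 4 → Fin 4 → Fin 4 → ℝ) {B : ℝ} (hQ : ∀ i j k l, |Q i j k l| ≤ B) :
    ∃ P : MvPolynomial (LandauFree H × Fin 3) ℝ, P.totalDegree ≤ 4 ∧ ∀ a : LandauFree H → E3,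
      (β * ∑ z ∈ plaquettesTouching (boxEdges 4 (2 * H + 1)), ∑ i : Fin 4, ∑ j : Fin 4, ∑ k : Fin 4, ∑ l : Fin 4, Q i j k l *
        ((WithLp.ofLp (plaqVar H z.1 z.2.1.1 z.2.1.2 a i) ⬝ᵥ WithLp.ofLp (plaqVar H z.1 z.2.1.1 z.2.1.2 a j)) *
          (WithLp.ofLp (plaqVar H z.1 z.2.1.1 z.2.1.2 a k) ⬝ᵥ WithLp.ofLp (plaqVar H z.1 z.2.1.1 z.2.1.2 a l)))) =
        MvPolynomial.eval (flatten (LandauFree H) a) P :=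
  polyCert_const_mul β (polyCert_sum _ fun z _ => polyCert_quarticPairSum (H := H) z.1 z.2.1.1 z.2.1.2 Q hQ)

/-- ★ **Crude second moment of the polynomial quartic Wilson vertex**: `E₀[W²] ≤ (256·81·(60·1036²)²·4096²)·B²·H⁸/β²` for `H ≥ 1`, `β > 0`. -/
theorem gaussAvg_quarticPairVertex_sq_le (hH : 1 ≤ H) {β : ℝ} (hβ : 0 < β) (Q : Fin 4 → Fin 4 → Fin 4 → Fin 4 → ℝ) {B : ℝ}
    (hQ : ∀ i j k l, |Q i j k l| ≤ B) :
    gaussAvg β H (fun a => (β * ∑ z ∈ plaquettesTouching (boxEdges 4 (2 * H + 1)), ∑ i : Fin 4, ∑ j : Fin 4, ∑ k : Fin 4, ∑ l : Fin 4, Q i j k l *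
        ((WithLp.ofLp (plaqVar H z.1 z.2.1.1 z.2.1.2 a i) ⬝ᵥ WithLp.ofLp (plaqVar H z.1 z.2.1.1 z.2.1.2 a j)) *
          (WithLp.ofLp (plaqVar H z.1 z.2.1.1 z.2.1.2 a k) ⬝ᵥ WithLp.ofLp (plaqVar H z.1 z.2.1.1 z.2.1.2 a l)))) ^ 2) ≤
      (256 * (81 * (60 * 1036 ^ 2) ^ 2) * 4096 ^ 2) * B ^ 2 * (H : ℝ) ^ 8 / β ^ 2 := by
  classical
  set PT := plaquettesTouching (boxEdges 4 (2 * H + 1)) with hPT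
  have hB : 0 ≤ B := (abs_nonneg _).trans (hQ 0 0 0 0)
  -- pointwise majorant
  have hpt : ∀ a : LandauFree H → E3, (β * ∑ z ∈ PT, ∑ i : Fin 4, ∑ j : Fin 4, ∑ k : Fin 4, ∑ l : Fin 4, Q i j k l *
      ((WithLp.ofLp (plaqVar H z.1 z.2.1.1 z.2.1.2 a i) ⬝ᵥ WithLp.ofLp (plaqVar H z.1 z.2.1.1 z.2.1.2 a j)) *
        (WithLp.ofLp (plaqVar H z.1 z.2.1.1 z.2.1.2 a k) ⬝ᵥ WithLp.ofLp (plaqVar H z.1 z.2.1.1 z.2.1.2 a l)))) ^ 2 ≤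
      (β ^ 2 * PT.card * (256 * B ^ 2)) * ∑ z ∈ PT, (∑ i : Fin 4, ‖plaqVar H z.1 z.2.1.1 z.2.1.2 a i‖ ^ 2) ^ 4 := by
    intro a
    have hterm : ∀ z ∈ PT, (∑ i : Fin 4, ∑ j : Fin 4, ∑ k : Fin 4, ∑ l : Fin 4, Q i j k l *
        ((WithLp.ofLp (plaqVar H z.1 z.2.1.1 z.2.1.2 a i) ⬝ᵥ WithLp.ofLp (plaqVar H z.1 z.2.1.1 z.2.1.2 a j)) *
          (WithLp.ofLp (plaqVar H z.1 z.2.1.1 z.2.1.2 a k) ⬝ᵥ WithLp.ofLp (plaqVar H z.1 z.2.1.1 z.2.1.2 a l)))) ^ 2 ≤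
        (256 * B ^ 2) * (∑ i : Fin 4, ‖plaqVar H z.1 z.2.1.1 z.2.1.2 a i‖ ^ 2) ^ 4 := by
      intro z _
      have h := WilsonTaylor.abs_quarticPairSum_le Q hQ (plaqVar H z.1 z.2.1.1 z.2.1.2 a)
      have h0 : 0 ≤ 16 * B * (∑ i : Fin 4, ‖plaqVar H z.1 z.2.1.1 z.2.1.2 a i‖ ^ 2) ^ 2 := by positivity
      calc _ = |∑ i : Fin 4, ∑ j : Fin 4, ∑ k : Fin 4, ∑ l : Fin 4, Q i j k l *
            ((WithLp.ofLp (plaqVar H z.1 z.2.1.1 z.2.1.2 a i) ⬝ᵥ WithLp.ofLp (plaqVar H z.1 z.2.1.1 z.2.1.2 a j)) *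
              (WithLp.ofLp (plaqVar H z.1 z.2.1.1 z.2.1.2 a k) ⬝ᵥ WithLp.ofLp (plaqVar H z.1 z.2.1.1 z.2.1.2 a l)))| ^ 2 := (sq_abs _).symm
        _ ≤ (16 * B * (∑ i : Fin 4, ‖plaqVar H z.1 z.2.1.1 z.2.1.2 a i‖ ^ 2) ^ 2) ^ 2 := pow_le_pow_left₀ (abs_nonneg _) h 2
        _ = _ := by ring
    have hcs := sq_sum_le_card_mul_sum_sq (s := PT) (f := fun z => ∑ i : Fin 4, ∑ j : Fin 4, ∑ k : Fin 4, ∑ l : Fin 4, Q i j k l *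
        ((WithLp.ofLp (plaqVar H z.1 z.2.1.1 z.2.1.2 a i) ⬝ᵥ WithLp.ofLp (plaqVar H z.1 z.2.1.1 z.2.1.2 a j)) *
          (WithLp.ofLp (plaqVar H z.1 z.2.1.1 z.2.1.2 a k) ⬝ᵥ WithLp.ofLp (plaqVar H z.1 z.2.1.1 z.2.1.2 a l))))
    rw [mul_pow]
    calc β ^ 2 * (∑ z ∈ PT, ∑ i : Fin 4, ∑ j : Fin 4, ∑ k : Fin 4, ∑ l : Fin 4, Q i j k l *
          ((WithLp.ofLp (plaqVar H z.1 z.2.1.1 z.2.1.2 a i) ⬝ᵥ WithLp.ofLp (plaqVar H z.1 z.2.1.1 z.2.1.2 a j)) *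
            (WithLp.ofLp (plaqVar H z.1 z.2.1.1 z.2.1.2 a k) ⬝ᵥ WithLp.ofLp (plaqVar H z.1 z.2.1.1 z.2.1.2 a l)))) ^ 2
        ≤ β ^ 2 * ((PT.card : ℝ) * ∑ z ∈ PT, (∑ i : Fin 4, ∑ j : Fin 4, ∑ k : Fin 4, ∑ l : Fin 4, Q i j k l *
          ((WithLp.ofLp (plaqVar H z.1 z.2.1.1 z.2.1.2 a i) ⬝ᵥ WithLp.ofLp (plaqVar H z.1 z.2.1.1 z.2.1.2 a j)) *
            (WithLp.ofLp (plaqVar H z.1 z.2.1.1 z.2.1.2 a k) ⬝ᵥ WithLp.ofLp (plaqVar H z.1 z.2.1.1 z.2.1.2 a l)))) ^ 2) :=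
          mul_le_mul_of_nonneg_left hcs (sq_nonneg _)
      _ ≤ β ^ 2 * ((PT.card : ℝ) * ∑ z ∈ PT, (256 * B ^ 2) * (∑ i : Fin 4, ‖plaqVar H z.1 z.2.1.1 z.2.1.2 a i‖ ^ 2) ^ 4) :=
          mul_le_mul_of_nonneg_left (mul_le_mul_of_nonneg_left (Finset.sum_le_sum hterm) (Nat.cast_nonneg _)) (sq_nonneg _)
      _ = _ := by rw [← Finset.mul_sum]; ring
  have hc : 0 ≤ β ^ 2 * PT.card * (256 * B ^ 2) := by positivity
  have hcard := TiltSup.card_plaquettesTouching_le' hH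
  have hPT0 : (0 : ℝ) ≤ PT.card := Nat.cast_nonneg _
  calc _ ≤ gaussAvg β H (fun a => (β ^ 2 * PT.card * (256 * B ^ 2)) * ∑ z ∈ PT, (∑ i : Fin 4, ‖plaqVar H z.1 z.2.1.1 z.2.1.2 a i‖ ^ 2) ^ 4) :=
        gaussAvg_mono_of_nonneg H hβ (fun a => sq_nonneg _) hpt (QuarticL2Proof.integrable_wilson_majorant H hβ _)
    _ ≤ (β ^ 2 * PT.card * (256 * B ^ 2)) * (PT.card * (81 * (60 * 1036 ^ 2) ^ 2 / β ^ 4)) := QuarticL2Proof.gaussAvg_wilson_majorant_le H hβ hc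
    _ = 256 * (81 * (60 * 1036 ^ 2) ^ 2) * B ^ 2 * (PT.card : ℝ) ^ 2 / β ^ 2 := by field_simp
    _ ≤ 256 * (81 * (60 * 1036 ^ 2) ^ 2) * B ^ 2 * (4096 * (H : ℝ) ^ 4) ^ 2 / β ^ 2 := by
        have h2 : (PT.card : ℝ) ^ 2 ≤ (4096 * (H : ℝ) ^ 4) ^ 2 := pow_le_pow_left₀ hPT0 hcard 2
        exact div_le_div_of_nonneg_right (mul_le_mul_of_nonneg_left h2 (by positivity)) (by positivity)
    _ = _ := by ring

end EdgeChartGaussian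

/-! ## §3 The row on `μ_{D′}` -/

namespace GaussRestrict

open EdgeChartGaussian (polyCert_const polyCert_sub polyCert_mul polyCert_pow polyCert_linCurvSq gaussAvg_sq_mul_sq_le_of_polyCert
  gaussAvg_centred_linCurvSq_sq_le integrable_polyCert_mul_gaussWeight measurable_linCurvSq)
open LaplaceSandwich (flatten)

variable {H : ℕ} {β : ℝ}

/-- ★★ **K3′ exact row E1, Wilson quartic vertex, on the cut small-field set** (see the module docstring). -/
theorem abs_tiltCum3_muSet_linCurvSq_linCurvSq_quarticPairVertex_le : ∃ C : ℝ, 0 ≤ C ∧ ∀ H : ℕ, 1 ≤ H → ∀ β : ℝ, 0 < β →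
    ∀ B : ℝ, ∀ Q : Fin 4 → Fin 4 → Fin 4 → Fin 4 → ℝ, (∀ i j k l, |Q i j k l| ≤ B) →
    ∀ x y : Site 4, ∀ μ₁ ν₁ μ₂ ν₂ : Fin 4, ∀ s : ℝ, 0 ≤ s → ∀ D : Set (LandauFree H → E3), MeasurableSet D → D ⊆ smallField H s →
    ∀ τ : ℝ, gaussAvg β H (fun a => 1 - D.indicator (fun _ => (1 : ℝ)) a) ≤ τ → τ ≤ 1 / 2 →
    |Tilt.tiltCum3 ((((volume : Measure (LandauFree H → E3)).restrict D).withDensity fun a => ENNReal.ofReal (gaussWeight β H a)))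
        (fun a => β * ∑ z ∈ plaquettesTouching (boxEdges 4 (2 * H + 1)), ∑ i : Fin 4, ∑ j : Fin 4, ∑ k : Fin 4, ∑ l : Fin 4, Q i j k l *
          ((WithLp.ofLp (plaqVar H z.1 z.2.1.1 z.2.1.2 a i) ⬝ᵥ WithLp.ofLp (plaqVar H z.1 z.2.1.1 z.2.1.2 a j)) *
            (WithLp.ofLp (plaqVar H z.1 z.2.1.1 z.2.1.2 a k) ⬝ᵥ WithLp.ofLp (plaqVar H z.1 z.2.1.1 z.2.1.2 a l)))) 0 (linCurvSq H (x, μ₁, ν₁)) (linCurvSq H (y, μ₂, ν₂))| ≤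
      β⁻¹ ^ 3 * (C * B * (1 + Real.log H) ^ 5 * (1 + Real.sqrt τ * (H : ℝ) ^ 4)) := by
  obtain ⟨C₃, hC₃0, hC3⟩ := EdgeChartGaussian.abs_gaussCum3_centredLinCurvSq_quarticPairVertex_le
  obtain ⟨CV, hCV0, hV⟩ := gaussAvg_centred_linCurvSq_sq_le
  set CW : ℝ := 256 * (81 * (60 * 1036 ^ 2) ^ 2) * 4096 ^ 2 with hCW
  have hCW0 : 0 ≤ CW := by rw [hCW]; positivity
  refine ⟨max C₃ (3728 * CV * Real.sqrt CW), le_max_of_le_left hC₃0, fun H hH β hβ B Q hQ x y μ₁ ν₁ μ₂ ν₂ s hs0 D hDm hDs τ hτ hτ2 => ?_⟩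
  classical
  set PT := plaquettesTouching (boxEdges 4 (2 * H + 1)) with hPT
  set p : Plaq 4 := (x, μ₁, ν₁) with hp
  set q : Plaq 4 := (y, μ₂, ν₂) with hq
  set W : (LandauFree H → E3) → ℝ := (fun a => β * ∑ z ∈ plaquettesTouching (boxEdges 4 (2 * H + 1)), ∑ i : Fin 4, ∑ j : Fin 4, ∑ k : Fin 4, ∑ l : Fin 4, Q i j k l *
          ((WithLp.ofLp (plaqVar H z.1 z.2.1.1 z.2.1.2 a i) ⬝ᵥ WithLp.ofLp (plaqVar H z.1 z.2.1.1 z.2.1.2 a j)) *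
            (WithLp.ofLp (plaqVar H z.1 z.2.1.1 z.2.1.2 a k) ⬝ᵥ WithLp.ofLp (plaqVar H z.1 z.2.1.1 z.2.1.2 a l)))) with hWdef
  have hL1 : 1 ≤ 1 + Real.log H := by
    have : (1 : ℝ) ≤ H := by exact_mod_cast hH
    have h' := Real.log_nonneg this; linarith only [h']
  have hL0 : 0 ≤ 1 + Real.log H := zero_le_one.trans hL1
  have hH0 : (0 : ℝ) < H := by exact_mod_cast Nat.lt_of_lt_of_le Nat.zero_lt_one hH
  have hB0 : 0 ≤ B := (abs_nonneg _).trans (hQ 0 0 0 0)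
  -- ### certificates, measurability, sixth moments
  have c₁ := polyCert_linCurvSq H p
  have c₂ := polyCert_linCurvSq H q
  have cW : ∃ P : MvPolynomial (LandauFree H × Fin 3) ℝ, P.totalDegree ≤ 4 ∧ ∀ a : LandauFree H → E3, W a = MvPolynomial.eval (flatten (LandauFree H) a) P :=
    EdgeChartGaussian.polyCert_quarticPairVertex (H := H) β Q hQ
  have m₁ : Measurable (linCurvSq H p) := measurable_linCurvSq H p
  have m₂ : Measurable (linCurvSq H q) := measurable_linCurvSq H q
  have measW : Measurable W := EdgeChartGaussian.measurable_of_polyCert cW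
  have i₁ : Integrable (fun a => linCurvSq H p a ^ 6 * gaussWeight β H a) := integrable_polyCert_mul_gaussWeight H hβ (polyCert_pow c₁ 6)
  have i₂ : Integrable (fun a => linCurvSq H q a ^ 6 * gaussWeight β H a) := integrable_polyCert_mul_gaussWeight H hβ (polyCert_pow c₂ 6)
  have iW : Integrable (fun a => W a ^ 6 * gaussWeight β H a) := integrable_polyCert_mul_gaussWeight H hβ (polyCert_pow cW 6)
  -- ### the Gaussian exact size (this seat's E₀-core) and the identification with the centred triple moment
  set mp := gaussAvg β H (linCurvSq H p) with hmp
  set mq := gaussAvg β H (linCurvSq H q) with hmq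
  set mW := gaussAvg β H W with hmW
  have hE := hC3 H hH β hβ B Q hQ p q
  have hcF : ∃ P : MvPolynomial (LandauFree H × Fin 3) ℝ, P.totalDegree ≤ 2 + 2 ∧ ∀ a,
      (linCurvSq H p a - mp) * (linCurvSq H q a - mq) = MvPolynomial.eval (flatten (LandauFree H) a) P :=
    polyCert_mul (polyCert_sub c₁ (polyCert_const _ 2)) (polyCert_sub c₂ (polyCert_const _ 2))
  have jFW : Integrable (fun a => (linCurvSq H p a - mp) * (linCurvSq H q a - mq) * W a * gaussWeight β H a) :=
    integrable_polyCert_mul_gaussWeight H hβ (polyCert_mul hcF cW)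
  have jF : Integrable (fun a => (linCurvSq H p a - mp) * (linCurvSq H q a - mq) * gaussWeight β H a) :=
    integrable_polyCert_mul_gaussWeight H hβ hcF
  have hcent : gaussAvg β H (fun a => (linCurvSq H p a - mp) * (linCurvSq H q a - mq) * (W a - mW)) =
      gaussAvg β H (fun a => (linCurvSq H p a - mp) * (linCurvSq H q a - mq) * W a) -
        gaussAvg β H (fun a => (linCurvSq H p a - mp) * (linCurvSq H q a - mq)) * mW := by
    have e : (fun a => (linCurvSq H p a - mp) * (linCurvSq H q a - mq) * (W a - mW)) =
        fun a => (linCurvSq H p a - mp) * (linCurvSq H q a - mq) * W a + (-mW) * ((linCurvSq H p a - mp) * (linCurvSq H q a - mq)) := by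
      funext a; ring
    have jF' : Integrable (fun a => (-mW) * ((linCurvSq H p a - mp) * (linCurvSq H q a - mq)) * gaussWeight β H a) :=
      (jF.const_mul (-mW)).congr (Filter.Eventually.of_forall fun a => by ring)
    rw [e, EdgeChartGaussian.gaussAvg_add β H jFW jF', EdgeChartGaussian.gaussAvg_const_mul]; ring
  -- ### on-`D` bounds (qualitative)
  obtain ⟨N, hN⟩ : ∃ N : ℝ, N = (PT.card : ℝ) := ⟨_, rfl⟩
  have hN0 : 0 ≤ N := by rw [hN]; exact Nat.cast_nonneg _
  set BD : ℝ := 16 * s ^ 2 + β * N * (256 * B * s ^ 4) with hBD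
  have hBD0 : 0 ≤ BD := by positivity
  have hLD : ∀ {z : Site 4} {μ ν : Fin 4}, ∀ a ∈ D, |linCurvSq H (z, μ, ν) a| ≤ BD := by
    intro z μ ν a ha
    have h1 := TiltSup.linCurvSq_le hs0 (hDs ha) z μ ν
    have h0 : 0 ≤ linCurvSq H (z, μ, ν) a := Finset.sum_nonneg fun c _ => sq_nonneg _
    have h2 : 0 ≤ β * N * (256 * B * s ^ 4) := by positivity
    rw [abs_of_nonneg h0, hBD]; linarith only [h1, h2]
  have hWD : ∀ a ∈ D, |W a| ≤ BD := by
    intro a ha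
    have hterm : ∀ z ∈ PT, |∑ i : Fin 4, ∑ j : Fin 4, ∑ k : Fin 4, ∑ l : Fin 4, Q i j k l *
        ((WithLp.ofLp (plaqVar H z.1 z.2.1.1 z.2.1.2 a i) ⬝ᵥ WithLp.ofLp (plaqVar H z.1 z.2.1.1 z.2.1.2 a j)) *
          (WithLp.ofLp (plaqVar H z.1 z.2.1.1 z.2.1.2 a k) ⬝ᵥ WithLp.ofLp (plaqVar H z.1 z.2.1.1 z.2.1.2 a l)))| ≤ 256 * B * s ^ 4 := by
      intro z _
      refine (WilsonTaylor.abs_quarticPairSum_le Q hQ _).trans ?_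
      have hS := TiltSup.sum_norm_plaqVar_sq_le hs0 (hDs ha) z.1 z.2.1.1 z.2.1.2
      have hS0 : 0 ≤ ∑ i : Fin 4, ‖plaqVar H z.1 z.2.1.1 z.2.1.2 a i‖ ^ 2 := Finset.sum_nonneg fun i _ => sq_nonneg _
      calc 16 * B * (∑ i : Fin 4, ‖plaqVar H z.1 z.2.1.1 z.2.1.2 a i‖ ^ 2) ^ 2 ≤ 16 * B * (4 * s ^ 2) ^ 2 :=
            mul_le_mul_of_nonneg_left (pow_le_pow_left₀ hS0 hS 2) (by positivity)
        _ = 256 * B * s ^ 4 := by ring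
    have hsum : |∑ z ∈ PT, ∑ i : Fin 4, ∑ j : Fin 4, ∑ k : Fin 4, ∑ l : Fin 4, Q i j k l *
        ((WithLp.ofLp (plaqVar H z.1 z.2.1.1 z.2.1.2 a i) ⬝ᵥ WithLp.ofLp (plaqVar H z.1 z.2.1.1 z.2.1.2 a j)) *
          (WithLp.ofLp (plaqVar H z.1 z.2.1.1 z.2.1.2 a k) ⬝ᵥ WithLp.ofLp (plaqVar H z.1 z.2.1.1 z.2.1.2 a l)))| ≤ N * (256 * B * s ^ 4) := by
      refine (Finset.abs_sum_le_sum_abs _ _).trans ((Finset.sum_le_sum hterm).trans (le_of_eq ?_))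
      rw [Finset.sum_const, nsmul_eq_mul, hN]
    rw [hWdef]; dsimp only
    rw [abs_mul, abs_of_pos hβ, hBD]
    have h16 : 0 ≤ 16 * s ^ 2 := by positivity
    calc β * _ ≤ β * (N * (256 * B * s ^ 4)) := mul_le_mul_of_nonneg_left hsum hβ.le
      _ ≤ _ := by linarith only [h16]
  -- ### the centred Gaussian sizes
  have hcL : ∀ r : Plaq 4, ∃ P : MvPolynomial (LandauFree H × Fin 3) ℝ, P.totalDegree ≤ 2 ∧
      ∀ a, linCurvSq H r a - gaussAvg β H (linCurvSq H r) = MvPolynomial.eval (flatten (LandauFree H) a) P := fun r =>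
    polyCert_sub (polyCert_linCurvSq H r) (polyCert_const _ 2)
  have hcWc : ∃ P : MvPolynomial (LandauFree H × Fin 3) ℝ, P.totalDegree ≤ 4 ∧ ∀ a : LandauFree H → E3,
      W a - mW = MvPolynomial.eval (flatten (LandauFree H) a) P := polyCert_sub cW (polyCert_const _ 4)
  obtain ⟨u, hu⟩ : ∃ u : ℝ, u = Real.sqrt (CV * (1 + Real.log H) ^ 2 / β ^ 2) := ⟨_, rfl⟩
  obtain ⟨v, hv⟩ : ∃ v : ℝ, v = Real.sqrt (CW * B ^ 2 * (H : ℝ) ^ 8 / β ^ 2) := ⟨_, rfl⟩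
  have hu0 : 0 ≤ u := by rw [hu]; exact Real.sqrt_nonneg _
  have hv0 : 0 ≤ v := by rw [hv]; exact Real.sqrt_nonneg _
  have hu2 : u ^ 2 = CV * (1 + Real.log H) ^ 2 / β ^ 2 := by rw [hu]; exact Real.sq_sqrt (by positivity)
  have hv2 : v ^ 2 = CW * B ^ 2 * (H : ℝ) ^ 8 / β ^ 2 := by rw [hv]; exact Real.sq_sqrt (by positivity)
  have a₁ : gaussAvg β H (fun a => (linCurvSq H p a - mp) ^ 2) ≤ u ^ 2 := (hV H hH β hβ p).trans (le_of_eq hu2.symm)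
  have a₂ : gaussAvg β H (fun a => (linCurvSq H q a - mq) ^ 2) ≤ u ^ 2 := (hV H hH β hβ q).trans (le_of_eq hu2.symm)
  have a₃ : gaussAvg β H (fun a => (W a - mW) ^ 2) ≤ v ^ 2 := by
    have jW1 : Integrable (fun a => W a * gaussWeight β H a) := integrable_polyCert_mul_gaussWeight H hβ cW
    have jW2 : Integrable (fun a => W a * W a * gaussWeight β H a) := integrable_polyCert_mul_gaussWeight H hβ (polyCert_mul cW cW)
    rw [hmW, GaussNormalForm.gaussAvg_sub_avg_sq_eq_gaussCov hβ jW1 jW2, gaussCov]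
    have hsq : gaussAvg β H (fun a => W a * W a) ≤ v ^ 2 := by
      rw [hv2, show (fun a => W a * W a) = fun a => W a ^ 2 from funext fun a => by ring, hWdef, hCW]
      exact EdgeChartGaussian.gaussAvg_quarticPairVertex_sq_le hH hβ Q hQ
    nlinarith [mul_self_nonneg (gaussAvg β H W)]
  have n₂ : 0 ≤ gaussAvg β H (fun a => (linCurvSq H q a - mq) ^ 2) := EdgeChartGaussian.gaussAvg_nonneg H hβ fun a => sq_nonneg _
  have n₃ : 0 ≤ gaussAvg β H (fun a => (W a - mW) ^ 2) := EdgeChartGaussian.gaussAvg_nonneg H hβ fun a => sq_nonneg _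
  -- Bonami–Nelson products (degrees 2,2 → 81; 2,4 → 729; (2+2),4 → 6561)
  have A12 : gaussAvg β H (fun a => ((linCurvSq H p a - mp) * (linCurvSq H q a - mq)) ^ 2) ≤ 81 * (u ^ 2 * u ^ 2) := by
    have h := gaussAvg_sq_mul_sq_le_of_polyCert H hβ (hcL p) (hcL q)
    rw [show ((3 : ℝ) ^ (2 + 2)) = 81 by norm_num, mul_assoc] at h
    refine le_trans (le_of_eq (congrArg _ (funext fun a => by ring))) (h.trans ?_)
    exact mul_le_mul_of_nonneg_left (mul_le_mul a₁ a₂ n₂ (sq_nonneg u)) (by norm_num)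
  have A13 : gaussAvg β H (fun a => ((linCurvSq H p a - mp) * (W a - mW)) ^ 2) ≤ 729 * (u ^ 2 * v ^ 2) := by
    have h := gaussAvg_sq_mul_sq_le_of_polyCert H hβ (hcL p) hcWc
    rw [show ((3 : ℝ) ^ (2 + 4)) = 729 by norm_num, mul_assoc] at h
    refine le_trans (le_of_eq (congrArg _ (funext fun a => by ring))) (h.trans ?_)
    exact mul_le_mul_of_nonneg_left (mul_le_mul a₁ a₃ n₃ (sq_nonneg u)) (by norm_num)
  have A23 : gaussAvg β H (fun a => ((linCurvSq H q a - mq) * (W a - mW)) ^ 2) ≤ 729 * (u ^ 2 * v ^ 2) := by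
    have h := gaussAvg_sq_mul_sq_le_of_polyCert H hβ (hcL q) hcWc
    rw [show ((3 : ℝ) ^ (2 + 4)) = 729 by norm_num, mul_assoc] at h
    refine le_trans (le_of_eq (congrArg _ (funext fun a => by ring))) (h.trans ?_)
    exact mul_le_mul_of_nonneg_left (mul_le_mul a₂ a₃ n₃ (sq_nonneg u)) (by norm_num)
  have A123 : gaussAvg β H (fun a => ((linCurvSq H p a - mp) * (linCurvSq H q a - mq) * (W a - mW)) ^ 2) ≤
      6561 * (81 * (u ^ 2 * u ^ 2) * v ^ 2) := by
    have h := gaussAvg_sq_mul_sq_le_of_polyCert H hβ (polyCert_mul (hcL p) (hcL q)) hcWc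
    rw [show ((3 : ℝ) ^ (2 + 2 + 4)) = 6561 by norm_num, mul_assoc] at h
    refine le_trans (le_of_eq (congrArg _ (funext fun a => by ring))) (h.trans ?_)
    refine mul_le_mul_of_nonneg_left (mul_le_mul A12 a₃ n₃ (mul_nonneg (by norm_num) (mul_nonneg (sq_nonneg u) (sq_nonneg u)))) (by norm_num)
  -- ### the centred transfer
  have key := abs_tiltCum3_muSet_zero_sub_gaussAvg_centred_le hβ hDm hτ hτ2 m₁ m₂ measW hBD0 hLD hLD hWD i₁ i₂ iW
    a₁ a₂ a₃ A12 A13 A23 A123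
  rw [hcent] at key
  -- ### bookkeeping
  have hτ0 : 0 ≤ Real.sqrt τ := Real.sqrt_nonneg _
  have s1 : Real.sqrt (u ^ 2) = u := Real.sqrt_sq hu0
  have s3 : Real.sqrt (v ^ 2) = v := Real.sqrt_sq hv0
  have s12 : Real.sqrt (81 * (u ^ 2 * u ^ 2)) = 9 * (u * u) := by
    rw [show 81 * (u ^ 2 * u ^ 2) = (9 * (u * u)) ^ 2 by ring]; exact Real.sqrt_sq (mul_nonneg (by norm_num) (mul_nonneg hu0 hu0))
  have s13 : Real.sqrt (729 * (u ^ 2 * v ^ 2)) = 27 * (u * v) := by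
    rw [show 729 * (u ^ 2 * v ^ 2) = (27 * (u * v)) ^ 2 by ring]; exact Real.sqrt_sq (mul_nonneg (by norm_num) (mul_nonneg hu0 hv0))
  have s123 : Real.sqrt (6561 * (81 * (u ^ 2 * u ^ 2) * v ^ 2)) = 729 * (u * u * v) := by
    rw [show 6561 * (81 * (u ^ 2 * u ^ 2) * v ^ 2) = (729 * (u * u * v)) ^ 2 by ring]
    exact Real.sqrt_sq (mul_nonneg (by norm_num) (mul_nonneg (mul_nonneg hu0 hu0) hv0))
  rw [s1, s3, s12, s13, s123] at key
  -- `u²v` in letters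
  have huv : u * u * v = CV * (1 + Real.log H) ^ 2 / β ^ 2 * (Real.sqrt CW * B * ((H : ℝ) ^ 4 / β)) := by
    rw [← sq, hu2, hv, show CW * B ^ 2 * (H : ℝ) ^ 8 / β ^ 2 = CW * (B * ((H : ℝ) ^ 4 / β)) ^ 2 by ring,
      Real.sqrt_mul hCW0, Real.sqrt_sq (by positivity)]
    ring
  have hb : |Tilt.tiltCum3 ((((volume : Measure (LandauFree H → E3)).restrict D).withDensity fun a => ENNReal.ofReal (gaussWeight β H a)))
        W 0 (linCurvSq H p) (linCurvSq H q) -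
      (gaussAvg β H (fun a => (linCurvSq H p a - mp) * (linCurvSq H q a - mq) * W a) -
        gaussAvg β H (fun a => (linCurvSq H p a - mp) * (linCurvSq H q a - mq)) * mW)| ≤ Real.sqrt τ * (3728 * (u * u * v)) :=
    key.trans (le_of_eq (by ring))
  have htri := abs_sub_abs_le_abs_sub (Tilt.tiltCum3 ((((volume : Measure (LandauFree H → E3)).restrict D).withDensity fun a =>
      ENNReal.ofReal (gaussWeight β H a))) W 0 (linCurvSq H p) (linCurvSq H q))
    (gaussAvg β H (fun a => (linCurvSq H p a - mp) * (linCurvSq H q a - mq) * W a) -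
        gaussAvg β H (fun a => (linCurvSq H p a - mp) * (linCurvSq H q a - mq)) * mW)
  have hmain : |Tilt.tiltCum3 ((((volume : Measure (LandauFree H → E3)).restrict D).withDensity fun a => ENNReal.ofReal (gaussWeight β H a)))
      W 0 (linCurvSq H p) (linCurvSq H q)| ≤ C₃ * B * (1 + Real.log H) ^ 5 * β⁻¹ ^ 3 + Real.sqrt τ * (3728 * (u * u * v)) := by
    linarith only [hE, hb, htri]
  refine hmain.trans ?_
  rw [huv]
  have hβ3 : β⁻¹ ^ 3 = 1 / β ^ 3 := by rw [inv_pow, one_div]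
  have hL25 : (1 + Real.log (H : ℝ)) ^ 2 ≤ (1 + Real.log (H : ℝ)) ^ 5 := pow_le_pow_right₀ hL1 (by norm_num)
  have hmax1 : C₃ ≤ max C₃ (3728 * CV * Real.sqrt CW) := le_max_left _ _
  have hmax2 : 3728 * CV * Real.sqrt CW ≤ max C₃ (3728 * CV * Real.sqrt CW) := le_max_right _ _
  have hsC : 0 ≤ Real.sqrt CW := Real.sqrt_nonneg _
  have e1 : Real.sqrt τ * (3728 * (CV * (1 + Real.log H) ^ 2 / β ^ 2 * (Real.sqrt CW * B * ((H : ℝ) ^ 4 / β)))) =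
      β⁻¹ ^ 3 * ((3728 * CV * Real.sqrt CW) * B * (1 + Real.log H) ^ 2 * (Real.sqrt τ * (H : ℝ) ^ 4)) := by
    rw [hβ3]; field_simp
  rw [e1, show C₃ * B * (1 + Real.log H) ^ 5 * β⁻¹ ^ 3 = β⁻¹ ^ 3 * (C₃ * B * (1 + Real.log H) ^ 5) by ring, ← mul_add]
  refine mul_le_mul_of_nonneg_left ?_ (pow_nonneg (inv_nonneg.2 hβ.le) 3)
  have t1 : C₃ * B * (1 + Real.log H) ^ 5 ≤ max C₃ (3728 * CV * Real.sqrt CW) * B * (1 + Real.log H) ^ 5 :=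
    mul_le_mul_of_nonneg_right (mul_le_mul_of_nonneg_right hmax1 hB0) (pow_nonneg hL0 5)
  have t2 : (3728 * CV * Real.sqrt CW) * B * (1 + Real.log H) ^ 2 * (Real.sqrt τ * (H : ℝ) ^ 4) ≤
      max C₃ (3728 * CV * Real.sqrt CW) * B * (1 + Real.log H) ^ 5 * (Real.sqrt τ * (H : ℝ) ^ 4) := by
    refine mul_le_mul_of_nonneg_right ?_ (by positivity)
    exact mul_le_mul (mul_le_mul_of_nonneg_right hmax2 hB0) hL25 (pow_nonneg hL0 2) (by positivity)
  calc C₃ * B * (1 + Real.log H) ^ 5 + (3728 * CV * Real.sqrt CW) * B * (1 + Real.log H) ^ 2 * (Real.sqrt τ * (H : ℝ) ^ 4)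
      ≤ max C₃ (3728 * CV * Real.sqrt CW) * B * (1 + Real.log H) ^ 5 +
          max C₃ (3728 * CV * Real.sqrt CW) * B * (1 + Real.log H) ^ 5 * (Real.sqrt τ * (H : ℝ) ^ 4) := add_le_add t1 t2
    _ = _ := by ring

end GaussRestrict

end Summit.QuantumFields.YangMills.Theorems.AllWindowsColdBoxBoxHighLine

end
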